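import Literature.NumberTheory.LFunctions.ChebyshevHalfLineBiasCharacters
import Literature.NumberTheory.LFunctions.ChebyshevHalfLineBiasVariantsProofs
import Literature.NumberTheory.LFunctions.DirichletLFunctionZeroReflection
import Literature.NumberTheory.LFunctions.DirichletLFunctionZeroFreeRegion
import HarnessLib

/-!
# GRH-IMPLYING criteria (Suzuki 2025, Thms 8 and 9, first halves), PROVED — «nothing here bears on the truth of RH»
# Landau's theorem for `L(s, χ)`: a constant sign of `Σ_{n ≤ x} Λ(n) Re χ(n)/√n · log(x/n)` (Thm 8) or `Σ_{p ≤ x} χ(p) log p √(x/p) log(x/p) ≤ 0` (Thm 9) eventually + no real zeros right of `β` ⟹ `L(s, χ) ≠ 0` on `Re s > β`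

M. Suzuki, *On variants of Chebyshev's conjecture*, Ramanujan J. **68** (2025) 95 = arXiv:2411.07436
[`Suzuki2025Chebyshev`; PUBLISHED, refereed], **Theorem 9, first half** (§4.2), AS PRINTED: «Let `χ` be a real Dirichlet character
such that `L(σ, χ) ≠ 0` for `σ > β (≥ 1/2)`. Suppose that `Σ_{p ≤ x} χ(p) log p · √(x/p) log(x/p) ≤ 0` (4.7) for all sufficiently
large `x > 1`. Then, `L(s, χ) ≠ 0` in the right-half plane `Re(s) > β`. In particular, if `β = 1/2`, the GRH for `L(s, χ)` holds.»
— the named fact `Suzuki2025Chebyshev_thm9_sign` of `ChebyshevHalfLineBiasCharacters.lean` (typed for non-principal real `χ`),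
DISCHARGED here: `Suzuki2025Chebyshev_thm9_sign_holds`; and **Theorem 8, first half** (§4.1), AS PRINTED: «Let `χ` be a
Dirichlet character such that `L(σ, χ) ≠ 0` for `σ > β (≥ 1/2)`. Suppose that `g_χ(x)` [`= Σ_{n ≤ x} Λ(n) Re(χ(n))/√n · log(x/n)`,
(1.12)] has constant sign for all sufficiently large `x > 1`. Then, `L(s, χ) ≠ 0` in the right-half plane `Re(s) > β`. In
particular, if `β = 1/2`, the GRH for `L(s, χ)` holds.» — the named fact `Suzuki2025Chebyshev_thm8_sign` (typed for `χ ≠ χ₀`),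
DISCHARGED here: `Suzuki2025Chebyshev_thm8_sign_holds`. GRH-type CRITERIA (implications from a zero-free hypothesis plus a
sign condition); nothing in this file is, or is worded as, progress toward RH or GRH. Theorems only (D-0014/D-0026).

## The printed proof (§4.2) and this formalisation

§4.2: with `f_χ = f₁ + f₂ + f₃` (primes / prime squares / higher powers), «if we rewrite (4.4) as
`−∫_1^∞ f₁(x) x^{−s+½} dx/x = (s−½)^{-2}(L'/L)(s) + ∫ f₂ … + ∫ f₃ …` (4.11), the second and third terms on the right-hand side
converge absolutely and uniformly on any compact subset in `Re(s) > 1/2`, and hence define analytic functions there. Suppose that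
`f₁(x)` has a constant sign for all sufficiently large `x > 1`. Then, the assumption `L(σ, χ) ≠ 0` for `σ > β (≥ 1/2)` implies that
the abscissa of convergence `σ_c` … satisfies `σ_c ≤ β` by Proposition 1. … This forces `L(s, χ) ≠ 0` in `Re(s) > β`.»

§4.1 (Thm 8): «we have `∫_1^∞ g_χ(x) x^{−s−1/2} dx = −(s − ½)^{-2} · ½[(L'/L)(s, χ) + (L'/L)(s, χ̄)]` … if `L(σ, χ) ≠ 0` for
`σ > β`, `(L'/L)(s, χ) + (L'/L)(s, χ̄)` [is regular on the real segment `σ > β`] … Proposition 1 … forces `L(s, χ)L(s, χ̄) ≠ 0`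
in `Re(s) > β`» (`L(σ, χ̄) = conj L(σ, χ)` for real `σ`).

Here, in the Landau variable `S = s − ½`, `x = e^t`:
* **The engine** `DirichletHalfLineLandau.entire_ne_zero_of_laplace_eq` (and its specialisation
  `lfunction_ne_zero_of_laplace_eq` to `Z₀ = L(·, χ)`) — the tree's `ζ`-engine
  `HalfLinePrimeSumLandau.riemannHypothesis_of_laplace_eq_mul` with `ζ₁` replaced by an entire `Z₀` (`L(·, χ)` for Thm 9,
  `L(·, χ)L(·, χ̄)` for Thm 8; `χ ≠ χ₀`) and the nonvanishing of `ζ₁` on the real axis replaced by the HYPOTHESIS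
  «`Z₀(σ) ≠ 0`, `β < σ < 1`» plus Mathlib's non-vanishing of `L(·, χ)` on `Re s ≥ 1`: if `G ≥ 0` eventually, `G(t)e^{−t} ∈ L¹`,
  and `∫₀^∞ G e^{−St} dt = (c(S)·(Z₀'/Z₀)(½+S) + P(S))/S²` for `Re S > 1`
  with `c`, `P` holomorphic on `Re S > 0`, `c ≠ 0` on `β − ½ < Re S < ½`, then `L(s, χ) ≠ 0` for `Re s > β` (Landau's lemma,
  the tree's `Landau.integrableOn_of_differentiableOn_union_convex` [Suzuki2025Chebyshev, §2 Prop 1]; order comparison at a zero).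
* **The hypothesis**: after `÷ √x`, (4.7) reads `Σ_{p ≤ e^t} χ(p)(log p/√p)(t − log p) ≤ 0`; splitting `χ(p) log p = d⁺(p) − d⁻(p)`,
  `d^± = log p · (±χ(p))₊ ∈ [0, Λ]`, the one-signed function is `G = φ_{d⁻} − φ_{d⁺}` with the tree's transforms
  `∫₀^∞ φ_d e^{−St} dt = S^{−2} L(d, ½+S)` (`HalfLinePrimeOnlyLandau.integral_weighted_mul_cexp`), so
  `∫₀^∞ G e^{−St} dt = −S^{−2} Σ_p χ(p) log p · p^{−½−S} = S^{−2}[(L'/L)(½+S, χ) + L(χΛ·𝟙_{not prime}, ½+S)]`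
  (`−L'/L(w, χ) = L(χΛ, w)`, Mathlib's `LSeries_twist_vonMangoldt_eq`); the correction `P(S) = L(χΛ·𝟙_{not prime}, ½+S)` is
  holomorphic on `Re S > 0` — the printed (4.11) — by domination with the tree's `abscissaOfAbsConv_vonMangoldt_nonPrime_le`.
* **Thm 8's hypothesis**: at `x = e^t`, `g_χ(e^t) = φ_{d⁺}(t) − φ_{d⁻}(t)` with `d^± = Λ · (±Re χ)₊ ∈ [0, Λ]`; with the sign
  `η = ±1` of the hypothesis, `G = η(φ_{d⁺} − φ_{d⁻}) ≥ 0` eventually and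
  `∫₀^∞ G e^{−St} dt = η S^{−2} Σ_n Λ(n) Re χ(n) n^{−½−S} = −(η/2) S^{−2} (Z₀'/Z₀)(½+S)`, `Z₀ = L(·, χ)L(·, χ̄)`
  (`Λ Re χ = ½(χΛ + χ̄Λ)`, `χ̄ = χ⁻¹` pointwise: `MulChar.star_apply'`; `L(σ, χ̄) = conj L(σ̄, χ)`: the tree's
  `DirichletZFR.conj_LFunction_conj`), so `c ≡ −η/2`, `P ≡ 0`.
* **«In particular»** (`β = ½ ⟹ GRH`): a zero with `0 < Re s < ½` reflects to `1 − s̄` (primitive case: the tree's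
  `LFunction_one_sub_conj_eq_zero`; passage to the inducing primitive character: `LFunction_eq_zero_iff_primitiveCharacter`).

## References
* [Suzuki2025Chebyshev] M. Suzuki, Ramanujan J. 68 (2025) 95 = arXiv:2411.07436: Thm 8 (§4.1, (1.12), (4.3)), Thm 9 (§4.2),
  (4.4), (4.9)–(4.11), §2 Prop 1.
* [MontgomeryVaughan2007] H. L. Montgomery, R. C. Vaughan, *Multiplicative Number Theory I*, §15.1 Lemma 15.1 (Landau); §10.1.
-/

noncomputable section

open Complex Filter Topology Set MeasureTheory ArithmeticFunction
open scoped Real LSeries.notation ComplexConjugate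

namespace Literature.NumberTheory.LFunctions

namespace DirichletHalfLineLandau

open ZetaScrewLandau

variable {q : ℕ} [NeZero q] {χ : DirichletCharacter ℂ q}

/-! ### Landau's theorem for transforms `(c(S)·(Z₀'/Z₀)(1/2+S) + P(S))/S²` (`Z₀` entire; `Z₀ = L(·, χ)`) -/

/-- `∫_1^∞ G(log x) x^{-(s+1)} dx = ∫_0^∞ G(t) e^{-st} dt` (substitution `x = e^t`). [folklore] -/
private theorem mellinIoi_comp_log (G : ℝ → ℝ) (s : ℂ) :
    Landau.mellinIoi (fun x ↦ G (Real.log x)) s =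
      ∫ t in Ioi (0 : ℝ), (G t : ℂ) * cexp (-s * t) := by
  unfold Landau.mellinIoi
  rw [integral_Ioi_one_eq_integral_Ioi_zero]
  refine setIntegral_congr_fun measurableSet_Ioi fun t _ ↦ ?_
  dsimp only
  rw [Real.log_exp, ofReal_exp_cpow, Complex.real_smul, Complex.ofReal_exp]
  have : cexp (t : ℂ) * cexp ((t : ℂ) * -(s + 1)) = cexp (-s * t) := by
    rw [← Complex.exp_add]
    congr 1
    ring
  rw [← this]
  ring

/-- `G(log x) x^{-(σ+1)} ∈ L¹(1,∞)` iff `G(t) e^{-σt} ∈ L¹(0,∞)` (real `σ`). [folklore] -/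
private theorem integrableOn_comp_log_iff (G : ℝ → ℝ) (σ : ℝ) :
    IntegrableOn (fun x : ℝ ↦ G (Real.log x) * x ^ (-(σ + 1))) (Ioi 1) ↔
      IntegrableOn (fun t : ℝ ↦ G t * Real.exp (-σ * t)) (Ioi 0) := by
  rw [integrableOn_Ioi_one_iff]
  refine integrableOn_congr_fun (fun t _ ↦ ?_) measurableSet_Ioi
  rw [smul_eq_mul, Real.log_exp, Real.rpow_def_of_pos (Real.exp_pos t), Real.log_exp]
  have : Real.exp t * Real.exp (t * -(σ + 1)) = Real.exp (-σ * t) := by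
    rw [← Real.exp_add]
    congr 1
    ring
  rw [← this]
  ring

/-- Complex integrability of `G(t) e^{-σt}` gives real integrability. [folklore] -/
private theorem integrableOn_exp_of_cexp {G : ℝ → ℝ} (hG : Measurable G) {σ : ℝ}
    (h : IntegrableOn (fun t : ℝ ↦ (G t : ℂ) * cexp (-(σ : ℂ) * t)) (Ioi 0)) :
    IntegrableOn (fun t : ℝ ↦ G t * Real.exp (-σ * t)) (Ioi 0) := by
  have h' : IntegrableOn (fun t : ℝ ↦ ‖(G t : ℂ) * cexp (-(σ : ℂ) * t)‖) (Ioi 0) := h.norm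
  have hmeas : AEStronglyMeasurable (fun t : ℝ ↦ G t * Real.exp (-σ * t))
      (volume.restrict (Ioi 0)) :=
    (hG.mul (Real.continuous_exp.measurable.comp (measurable_const.mul measurable_id))).aestronglyMeasurable
  refine (integrable_norm_iff hmeas).1 (h'.congr_fun (fun t _ ↦ ?_) measurableSet_Ioi)
  dsimp only
  rw [norm_mul, norm_mul, Complex.norm_real, Real.norm_eq_abs,
    ZetaScrewLaplace.norm_cexp_mul_ofReal, Real.norm_of_nonneg (Real.exp_pos _).le]
  simp

/-- `R(s) = (c(s) (Z₀'/Z₀)(1/2+s) + P(s))/s²` is differentiable at `s ≠ 0` with `Z₀(1/2+s) ≠ 0` where `c`, `P` are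
(`Z₀` entire). [folklore] -/
private theorem differentiableAt_R_gen {Z₀ : ℂ → ℂ} (hd : Differentiable ℂ Z₀) {c P : ℂ → ℂ} {s : ℂ}
    (hs0 : s ≠ 0) (hL : Z₀ (1 / 2 + s) ≠ 0) (hc : DifferentiableAt ℂ c s) (hP : DifferentiableAt ℂ P s) :
    DifferentiableAt ℂ
      (fun s : ℂ ↦ (c s * logDeriv Z₀ (1 / 2 + s) + P s) / s ^ 2) s := by
  have hlog : AnalyticAt ℂ (logDeriv Z₀) (1 / 2 + s) := by
    have h : logDeriv Z₀ = fun z ↦ deriv Z₀ z / Z₀ z := by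
      funext z; rw [logDeriv_apply]
    rw [h]
    exact (hd.analyticAt _).deriv.div (hd.analyticAt _) hL
  have hcomp : DifferentiableAt ℂ (fun s : ℂ ↦ logDeriv Z₀ (1 / 2 + s)) s :=
    hlog.differentiableAt.comp s (by fun_prop)
  exact ((hc.mul hcomp).add hP).div (by fun_prop) (pow_ne_zero 2 hs0)

/-- **Landau's theorem in the shape `(c(S)·(Z₀'/Z₀)(1/2+S) + P(S))/S²`** for an ENTIRE function `Z₀` with no zeros on
`Re s ≥ 1` and no real zeros in `(β, 1)` (`1/2 ≤ β`) — the tree's `ζ`-engine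
`HalfLinePrimeSumLandau.riemannHypothesis_of_laplace_eq_mul` with `ζ₁` replaced by `Z₀` (below: `Z₀ = L(·, χ)`, `χ ≠ χ₀`, for
Thm 9 and `Z₀ = L(·, χ)L(·, χ̄)` for Thm 8). Let `G : ℝ → ℝ` be measurable and non-negative on `(t₀, ∞)`, with `G(t)e^{-t}`
integrable on `(0, ∞)`, and suppose that for `Re S > 1` its Laplace transform is
`∫_0^∞ G(t) e^{-St} dt = (c(S)·(Z₀'/Z₀)(1/2 + S) + P(S))/S²` with `c`, `P` holomorphic on `Re S > 0` and `c(S) ≠ 0` for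
`β − 1/2 < Re S < 1/2`. Then `Z₀(s) ≠ 0` for `Re s > β`: by Landau's theorem (§2 Prop 1 of the paper; the tree's
`Landau.integrableOn_of_differentiableOn_union_convex`, the real segment `σ > β − 1/2` being free of singularities by
hypothesis) the transform `F` is holomorphic on `Re S > ε` for every `ε > β − 1/2`, whence
`(F(S)S² − P(S))·Z₀(1/2+S) = c(S)·Z₀'(1/2+S)` there; at a zero `w₀` with `β − 1/2 < Re w₀ < 1/2` the right side has order
`ord − 1` (`c(w₀) ≠ 0`), the left side order `≥ ord` — impossible.
[cite: Suzuki2025Chebyshev, §2 Prop 1; §4.1–4.2 (proofs of Thms 8 and 9)] -/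
theorem entire_ne_zero_of_laplace_eq {Z₀ : ℂ → ℂ} (hd : Differentiable ℂ Z₀)
    (hright : ∀ s : ℂ, 1 ≤ s.re → Z₀ s ≠ 0) {β : ℝ} (hβ : 1 / 2 ≤ β)
    (hreal : ∀ σ : ℝ, β < σ → σ < 1 → Z₀ σ ≠ 0)
    {G : ℝ → ℝ} (hG : Measurable G) {t₀ : ℝ} (hpos : ∀ t : ℝ, t₀ < t → 0 ≤ G t)
    (hint : IntegrableOn (fun t : ℝ ↦ (G t : ℂ) * cexp (-(1 : ℂ) * t)) (Ioi 0))
    {c P : ℂ → ℂ} (hc : DifferentiableOn ℂ c {s : ℂ | 0 < s.re})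
    (hc0 : ∀ s : ℂ, β - 1 / 2 < s.re → s.re < 1 / 2 → c s ≠ 0)
    (hP : DifferentiableOn ℂ P {s : ℂ | 0 < s.re})
    (htr : ∀ s : ℂ, 1 < s.re → ∫ t in Ioi (0 : ℝ), (G t : ℂ) * cexp (-s * t) =
      (c s * logDeriv Z₀ (1 / 2 + s) + P s) / s ^ 2) :
    ∀ s : ℂ, β < s.re → Z₀ s ≠ 0 := by
  intro w hw hLw
  -- no zeros with `Re w ≥ 1`
  rcases le_or_gt 1 w.re with h1 | h1
  · exact hright w h1 hLw
  -- `Z = L(1/2 + ·)` has no real zeros `σ > β − 1/2` and no zeros with `Re ≥ 1/2`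
  have hZreal : ∀ σ : ℝ, β - 1 / 2 < σ → Z₀ (1 / 2 + σ) ≠ 0 := by
    intro σ hσ
    rcases lt_or_ge (1 / 2 + σ) 1 with h | h
    · have := hreal (1 / 2 + σ) (by linarith) h
      push_cast at this
      exact this
    · exact hright _ (by simp; linarith)
  have hZright : ∀ s : ℂ, 1 / 2 ≤ s.re → Z₀ (1 / 2 + s) ≠ 0 := fun s hs ↦
    hright _ (by simp; linarith)
  -- the zero `w₀ = w - 1/2` of `Z`, with `β − 1/2 < Re w₀ < 1/2`
  set w₀ : ℂ := w - 1 / 2 with hw₀_def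
  have hw₀ : β - 1 / 2 < w₀.re := by simp [hw₀_def]; linarith
  have hw₀' : w₀.re < 1 / 2 := by simp [hw₀_def]; linarith
  have hzero : Z₀ (1 / 2 + w₀) = 0 := by
    rw [show (1 / 2 : ℂ) + w₀ = w by rw [hw₀_def]; ring]
    exact hLw
  -- the Mellin data
  set g : ℝ → ℝ := fun x ↦ G (Real.log x) with hg_def
  have hg : Measurable g := hG.comp Real.measurable_log
  set R : ℂ → ℂ := fun s ↦ (c s * logDeriv Z₀ (1 / 2 + s) + P s) / s ^ 2 with hR_def
  set ε : ℝ := ((β - 1 / 2) + w₀.re) / 2 with hε_def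
  have hεβ : β - 1 / 2 < ε := by rw [hε_def]; linarith
  have hεw : ε < w₀.re := by rw [hε_def]; linarith
  have hε : 0 < ε := by linarith
  have hε1 : ε < 1 := by linarith
  set ε₁ : ℝ := ((β - 1 / 2) + ε) / 2 with hε₁_def
  have hε₁β : β - 1 / 2 < ε₁ := by rw [hε₁_def]; linarith
  have hε₁ε : ε₁ < ε := by rw [hε₁_def]; linarith
  have hε₁0 : 0 < ε₁ := by linarith
  -- a zero-free thin rectangle around the real segment `[ε₁, 3]`
  set K : Set ℂ := (fun σ : ℝ ↦ (σ : ℂ)) '' Icc ε₁ 3 with hK_def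
  have hKc : IsCompact K := (isCompact_Icc.image Complex.continuous_ofReal)
  set U : Set ℂ := {s : ℂ | Z₀ (1 / 2 + s) ≠ 0} with hU_def
  have hUo : IsOpen U := by
    have : U = (fun s : ℂ ↦ Z₀ (1 / 2 + s)) ⁻¹' {0}ᶜ := rfl
    rw [this]
    exact isOpen_compl_singleton.preimage (hd.continuous.comp (by fun_prop))
  have hKU : K ⊆ U := by
    rintro _ ⟨σ, hσ, rfl⟩
    exact hZreal σ (by linarith [hσ.1])
  obtain ⟨d₀, hd₀, hthick⟩ := hKc.exists_thickening_subset_open hUo hKU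
  set W₀ : Set ℂ := {s : ℂ | ε₁ < s.re ∧ s.re < 3 ∧ -d₀ < s.im ∧ s.im < d₀} with hW₀_def
  have hW₀eq : W₀ = {s : ℂ | ε₁ < s.re} ∩ ({s : ℂ | s.re < 3} ∩ ({s : ℂ | -d₀ < s.im} ∩
      {s : ℂ | s.im < d₀})) := by
    ext s; simp [hW₀_def]
  have hW₀o : IsOpen W₀ := by
    rw [hW₀eq]
    exact (isOpen_lt continuous_const Complex.continuous_re).inter
      ((isOpen_lt Complex.continuous_re continuous_const).inter
        ((isOpen_lt continuous_const Complex.continuous_im).inter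
          (isOpen_lt Complex.continuous_im continuous_const)))
  have hW₀c : Convex ℝ W₀ := by
    rw [hW₀eq]
    exact (convex_halfSpace_re_gt _).inter ((convex_halfSpace_re_lt _).inter
      ((convex_halfSpace_im_gt _).inter (convex_halfSpace_im_lt _)))
  have hW₀U : W₀ ⊆ U := by
    intro s hs
    refine hthick (Metric.mem_thickening_iff.2 ⟨(s.re : ℂ), ⟨s.re, ⟨hs.1.le, hs.2.1.le⟩, rfl⟩, ?_⟩)
    rw [dist_eq_norm]
    have : s - (s.re : ℂ) = (s.im : ℂ) * I := by
      apply Complex.ext <;> simp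
    rw [this, norm_mul, Complex.norm_I, mul_one, Complex.norm_real, Real.norm_eq_abs, abs_lt]
    exact ⟨hs.2.2.1, hs.2.2.2⟩
  have hW₀r : ∀ σ : ℝ, ε < σ → σ ≤ 1 + 1 → (σ : ℂ) ∈ W₀ := by
    intro σ h1 h2
    simp only [hW₀_def, Set.mem_setOf_eq, ofReal_re, ofReal_im, neg_lt_zero]
    exact ⟨by linarith, by linarith, hd₀, hd₀⟩
  have hopen₀ : IsOpen {s : ℂ | 0 < s.re} := isOpen_lt continuous_const Complex.continuous_re
  have hW₀pos : ∀ s ∈ W₀, 0 < s.re := fun s hs ↦ by linarith [hs.1]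
  -- `R` is holomorphic on `{Re s > 1} ∪ W₀` and agrees with the transform on `Re s > 1`
  have hΦ : DifferentiableOn ℂ R ({s : ℂ | 1 < s.re} ∪ W₀) := by
    intro s hs
    have hre : 0 < s.re := by
      rcases hs with hs | hs
      · simp only [Set.mem_setOf_eq] at hs; linarith
      · exact hW₀pos s hs
    have hs0 : s ≠ 0 := fun h0 ↦ by rw [h0, zero_re] at hre; exact lt_irrefl _ hre
    have hL : Z₀ (1 / 2 + s) ≠ 0 := by
      rcases hs with hs | hs
      · exact hZright s (by simp only [Set.mem_setOf_eq] at hs; linarith)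
      · exact hW₀U hs
    exact (differentiableAt_R_gen hd hs0 hL (hc.differentiableAt (hopen₀.mem_nhds hre))
      (hP.differentiableAt (hopen₀.mem_nhds hre))).differentiableWithinAt
  have hagree : EqOn R (Landau.mellinIoi g) {s : ℂ | 1 < s.re} := by
    intro s hs
    simp only [Set.mem_setOf_eq] at hs
    show R s = Landau.mellinIoi (fun x ↦ G (Real.log x)) s
    rw [mellinIoi_comp_log, htr s hs]
  have hint' : IntegrableOn (fun x ↦ g x * x ^ (-((1 : ℝ) + 1))) (Ioi 1) := by
    show IntegrableOn (fun x ↦ G (Real.log x) * x ^ (-((1 : ℝ) + 1))) (Ioi 1)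
    rw [integrableOn_comp_log_iff]
    refine integrableOn_exp_of_cexp hG (σ := 1) ?_
    simpa using hint
  set X₁ : ℝ := Real.exp (max t₀ 0) with hX₁_def
  have hX₁ : 1 ≤ X₁ := Real.one_le_exp (le_max_right _ _)
  have hpos' : ∀ x : ℝ, X₁ < x → 0 ≤ g x := by
    intro x hx
    have hx0 : 0 < x := lt_trans (Real.exp_pos _) hx
    refine hpos _ (lt_of_le_of_lt (le_max_left t₀ 0) ?_)
    rw [← Real.log_exp (max t₀ 0)]
    exact Real.log_lt_log (Real.exp_pos _) hx
  -- Landau: absolute convergence for every `σ > ε`, holomorphy of `F` on `Re s > ε`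
  have hS : ∀ σ' : ℝ, ε < σ' → IntegrableOn (fun x ↦ g x * x ^ (-(σ' + 1))) (Ioi 1) :=
    fun σ' hσ' ↦ Landau.integrableOn_of_differentiableOn_union_convex hg hint' hX₁ hpos'
      hε1 hW₀o hW₀c hW₀r hΦ hagree hσ'
  set F : ℂ → ℂ := Landau.mellinIoi g with hF_def
  have hFdiff : DifferentiableOn ℂ F {s : ℂ | ε < s.re} :=
    Landau.differentiableOn_mellinIoi_of_forall hg hS
  set H : Set ℂ := {s : ℂ | ε < s.re} with hH_def
  have hHo : IsOpen H := isOpen_lt continuous_const Complex.continuous_re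
  have hHpre : IsPreconnected H := (convex_halfSpace_re_gt ε).isPreconnected
  have hH₀ : H ⊆ {s : ℂ | 0 < s.re} := fun s hs ↦ by
    simp only [hH_def, Set.mem_setOf_eq] at hs ⊢; linarith
  -- the identity `(F(s) s² − P(s)) L(1/2+s) = c(s) L'(1/2+s)` on `H`
  set Z : ℂ → ℂ := fun s ↦ Z₀ (1 / 2 + s) with hZ_def
  have hZd : Differentiable ℂ Z := hd.comp (by fun_prop)
  have hZa : ∀ s, AnalyticAt ℂ Z s := fun s ↦ hZd.analyticAt s
  have hderivZ : ∀ s, deriv Z s = deriv Z₀ (1 / 2 + s) := fun s ↦ by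
    simp only [hZ_def]
    exact deriv_comp_const_add Z₀ (1 / 2) s
  have hca : ∀ s ∈ H, AnalyticAt ℂ c s := fun s hs ↦ hc.analyticAt (hopen₀.mem_nhds (hH₀ hs))
  set G₁ : ℂ → ℂ := fun s ↦ F s * s ^ 2 - P s with hG₁_def
  have hGa : ∀ s ∈ H, AnalyticAt ℂ G₁ s := fun s hs ↦
    (((hFdiff.analyticOnNhd hHo) s hs).mul (analyticAt_id.pow 2)).sub
      (hP.analyticAt (hopen₀.mem_nhds (hH₀ hs)))
  have hf₁ : AnalyticOnNhd ℂ (G₁ * Z) H := fun s hs ↦ (hGa s hs).mul (hZa s)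
  have hf₂ : AnalyticOnNhd ℂ (c * deriv Z) H := fun s hs ↦ (hca s hs).mul (hZa s).deriv
  have h2H : (2 : ℂ) ∈ H := by simp [hH_def]; linarith
  have hev2 : (G₁ * Z) =ᶠ[𝓝 (2 : ℂ)] c * deriv Z := by
    have hopen : IsOpen {s : ℂ | 1 < s.re} := isOpen_lt continuous_const Complex.continuous_re
    filter_upwards [hopen.mem_nhds (show (2 : ℂ) ∈ {s : ℂ | 1 < s.re} by simp)] with s hs
    have hs' : 1 < s.re := hs
    have hL : Z₀ (1 / 2 + s) ≠ 0 := hZright s (by linarith)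
    have hs0 : s ≠ 0 := fun h ↦ by rw [h, zero_re] at hs'; linarith
    rw [Pi.mul_apply, Pi.mul_apply, hderivZ s]
    simp only [hG₁_def, hZ_def]
    rw [← hagree hs]
    simp only [hR_def]
    rw [logDeriv_apply]
    set A : ℂ := deriv Z₀ (1 / 2 + s)
    set B : ℂ := Z₀ (1 / 2 + s)
    field_simp
    ring
  have hEqOn : EqOn (G₁ * Z) (c * deriv Z) H :=
    hf₁.eqOn_of_preconnected_of_eventuallyEq hf₂ hHpre h2H hev2
  -- orders at `w₀`
  have hw₀H : w₀ ∈ H := by simp only [hH_def, Set.mem_setOf_eq]; exact hεw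
  have hev : c * deriv Z =ᶠ[𝓝 w₀] G₁ * Z := by
    filter_upwards [hHo.mem_nhds hw₀H] with s hs
    exact (hEqOn hs).symm
  have hZ0 : Z w₀ = 0 := hzero
  have hc_ord : analyticOrderAt c w₀ = 0 :=
    (hca w₀ hw₀H).analyticOrderAt_eq_zero.2 (hc0 w₀ hw₀ hw₀')
  have h1 : analyticOrderAt (deriv Z) w₀ + 1 = analyticOrderAt Z w₀ := by
    have := (hZa w₀).analyticOrderAt_deriv_add_one
    simpa [hZ0] using this
  have h2 : analyticOrderAt (c * deriv Z) w₀ = analyticOrderAt G₁ w₀ + analyticOrderAt Z w₀ := by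
    rw [analyticOrderAt_congr hev, analyticOrderAt_mul (hGa w₀ hw₀H) (hZa w₀)]
  have h3 : analyticOrderAt (c * deriv Z) w₀ = analyticOrderAt (deriv Z) w₀ := by
    rw [analyticOrderAt_mul (hca w₀ hw₀H) (hZa w₀).deriv, hc_ord, zero_add]
  rw [h3] at h2
  rw [h2] at h1
  -- `Z` is not locally zero (`L(3/2, χ) ≠ 0`), so its order is finite: contradiction
  generalize hoZ : analyticOrderAt Z w₀ = oZ at h1
  generalize hoG : analyticOrderAt G₁ w₀ = oG at h1
  cases oZ with
  | top =>
    have hloc : ∀ᶠ s in 𝓝 w₀, Z s = 0 := analyticOrderAt_eq_top.1 hoZ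
    have hall : EqOn Z 0 univ :=
      (hZd.differentiableOn.analyticOnNhd isOpen_univ).eqOn_zero_of_preconnected_of_eventuallyEq_zero
        isPreconnected_univ (Set.mem_univ w₀) hloc
    have h1' : Z 1 = 0 := hall (Set.mem_univ _)
    exact hZright 1 (by norm_num) h1'
  | coe n =>
    cases oG with
    | top => simp at h1
    | coe m =>
      have h' : (m + n + 1 : ℕ) = n := by exact_mod_cast h1
      omega

/-- **Landau's theorem in the shape `(c(S)·(L'/L)(1/2+S, χ) + P(S))/S²`** (the tree's `ζ`-engine
`HalfLinePrimeSumLandau.riemannHypothesis_of_laplace_eq_mul` for a non-principal Dirichlet character). Let `χ ≠ χ₀`,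
`1/2 ≤ β`, and suppose `L(σ, χ) ≠ 0` for real `β < σ < 1`. Let `G : ℝ → ℝ` be measurable and non-negative on `(t₀, ∞)`, with
`G(t)e^{-t}` integrable on `(0, ∞)`, and suppose that for `Re S > 1` its Laplace transform is
`∫_0^∞ G(t) e^{-St} dt = (c(S)·(L'/L)(1/2 + S, χ) + P(S))/S²` with `c`, `P` holomorphic on `Re S > 0` and `c(S) ≠ 0` for
`β − 1/2 < Re S < 1/2`. Then `L(s, χ) ≠ 0` for `Re s > β`: by Landau's theorem (§2 Prop 1 of the paper; the tree's
`Landau.integrableOn_of_differentiableOn_union_convex`, the real segment `σ > β − 1/2` being free of singularities by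
hypothesis and by Mathlib's non-vanishing on `Re ≥ 1`) the transform `F` is holomorphic on `Re S > ε` for every
`ε > β − 1/2`, whence `(F(S)S² − P(S))·L(1/2+S) = c(S)·L'(1/2+S)` there; at a zero `w₀` with `β − 1/2 < Re w₀ < 1/2` the right
side has order `ord − 1` (`c(w₀) ≠ 0`), the left side order `≥ ord` — impossible.
[cite: Suzuki2025Chebyshev, §2 Prop 1 and §4.2 (proof of Thm 9)] -/
theorem lfunction_ne_zero_of_laplace_eq (hχ : χ ≠ 1) {β : ℝ} (hβ : 1 / 2 ≤ β)
    (hreal : ∀ σ : ℝ, β < σ → σ < 1 → χ.LFunction σ ≠ 0)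
    {G : ℝ → ℝ} (hG : Measurable G) {t₀ : ℝ} (hpos : ∀ t : ℝ, t₀ < t → 0 ≤ G t)
    (hint : IntegrableOn (fun t : ℝ ↦ (G t : ℂ) * cexp (-(1 : ℂ) * t)) (Ioi 0))
    {c P : ℂ → ℂ} (hc : DifferentiableOn ℂ c {s : ℂ | 0 < s.re})
    (hc0 : ∀ s : ℂ, β - 1 / 2 < s.re → s.re < 1 / 2 → c s ≠ 0)
    (hP : DifferentiableOn ℂ P {s : ℂ | 0 < s.re})
    (htr : ∀ s : ℂ, 1 < s.re → ∫ t in Ioi (0 : ℝ), (G t : ℂ) * cexp (-s * t) =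
      (c s * logDeriv χ.LFunction (1 / 2 + s) + P s) / s ^ 2) :
    ∀ s : ℂ, β < s.re → χ.LFunction s ≠ 0 :=
  entire_ne_zero_of_laplace_eq (DirichletCharacter.differentiable_LFunction hχ)
    (fun _ hs ↦ DirichletCharacter.LFunction_ne_zero_of_one_le_re χ (Or.inl hχ) hs) hβ hreal hG hpos hint hc hc0 hP htr

/-! ### From the half-plane `Re s > 1/2` to the strip form of GRH -/

/-- For `χ ≠ χ₀`: if `L(s, χ) ≠ 0` for `Re s > 1/2`, then every zero in the open critical strip lies on `Re s = 1/2`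
(a zero with `0 < Re s < 1/2` reflects to the zero `1 − s̄` of the same `L`-function with `Re > 1/2`: the functional equation
for the inducing primitive character, `LFunction_one_sub_conj_eq_zero`, and `LFunction_eq_zero_iff_primitiveCharacter`).
[cite: MontgomeryVaughan2007, §10.1 (after Cor. 10.8)] -/
theorem riemannHypothesis_of_forall_ne_zero (hχ : χ ≠ 1)
    (h : ∀ s : ℂ, 1 / 2 < s.re → χ.LFunction s ≠ 0) : χ.RiemannHypothesis := by
  intro s hs h0 h1
  by_contra hne
  rcases lt_or_gt_of_ne hne with hlt | hgt
  · haveI : NeZero χ.conductor := ⟨χ.conductor_ne_zero⟩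
    have hs1 : s ≠ 1 := fun hh ↦ by rw [hh] at h1; simp at h1
    have hprim := (DirichletCharacter.LFunction_eq_zero_iff_primitiveCharacter χ h0 hs1).1 hs
    have hN : χ.conductor ≠ 1 := fun hc ↦ hχ (χ.eq_one_iff_conductor_eq_one.2 hc)
    have hrefl := LFunction_one_sub_conj_eq_zero χ.primitiveCharacter_isPrimitive hN hprim h0
    have hre' : 0 < (1 - conj s).re := by simp; linarith
    have hs1' : (1 - conj s) ≠ 1 := by
      intro hh
      have := congrArg Complex.re hh
      simp at this
      linarith
    have hχ' := (DirichletCharacter.LFunction_eq_zero_iff_primitiveCharacter χ hre' hs1').2 hrefl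
    exact h (1 - conj s) (by simp; linarith) hχ'
  · exact h s hgt hs

/-! ### The one-signed function of Thm 9 and its transform -/

/-- `A_d(t) = Σ_{n ≤ e^t} d(n)/√n` is monotone for `d ≥ 0`. [folklore] -/
private theorem monotone_count {d : ℕ → ℝ} (hd0 : ∀ n, 0 ≤ d n) :
    Monotone fun t : ℝ ↦ ∑ n ∈ Finset.Icc 1 ⌊Real.exp t⌋₊, d n / Real.sqrt n := by
  intro t u htu
  refine Finset.sum_le_sum_of_subset_of_nonneg
    (Finset.Icc_subset_Icc_right (Nat.floor_mono (Real.exp_le_exp.2 htu))) fun n _ _ ↦ ?_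
  exact div_nonneg (hd0 n) (Real.sqrt_nonneg _)

/-- `B_d(t) = Σ_{n ≤ e^t} d(n) log n/√n` is monotone for `d ≥ 0`. [folklore] -/
private theorem monotone_countLog {d : ℕ → ℝ} (hd0 : ∀ n, 0 ≤ d n) :
    Monotone fun t : ℝ ↦ ∑ n ∈ Finset.Icc 1 ⌊Real.exp t⌋₊, d n / Real.sqrt n * Real.log n := by
  intro t u htu
  refine Finset.sum_le_sum_of_subset_of_nonneg
    (Finset.Icc_subset_Icc_right (Nat.floor_mono (Real.exp_le_exp.2 htu))) fun n _ _ ↦ ?_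
  exact mul_nonneg (div_nonneg (hd0 n) (Real.sqrt_nonneg _)) (Real.log_natCast_nonneg n)

/-- `φ_d(t) = Σ_{n ≤ e^t} d(n)/√n (t − log n) = t A_d(t) − B_d(t)` is measurable. [folklore] -/
private theorem measurable_weighted {d : ℕ → ℝ} (hd0 : ∀ n, 0 ≤ d n) :
    Measurable fun t : ℝ ↦ ∑ n ∈ Finset.Icc 1 ⌊Real.exp t⌋₊, d n / Real.sqrt n * (t - Real.log n) := by
  have h : (fun t : ℝ ↦ ∑ n ∈ Finset.Icc 1 ⌊Real.exp t⌋₊, d n / Real.sqrt n * (t - Real.log n)) =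
      fun t ↦ t * (∑ n ∈ Finset.Icc 1 ⌊Real.exp t⌋₊, d n / Real.sqrt n)
        - ∑ n ∈ Finset.Icc 1 ⌊Real.exp t⌋₊, d n / Real.sqrt n * Real.log n := by
    funext t
    rw [Finset.mul_sum, ← Finset.sum_sub_distrib]
    refine Finset.sum_congr rfl fun n _ ↦ ?_
    ring
  rw [h]
  exact (measurable_id.mul (monotone_count hd0).measurable).sub (monotone_countLog hd0).measurable

omit [NeZero q] in
/-- `|Re χ(n)| ≤ 1`. [folklore] -/
private theorem abs_re_le_one (χ : DirichletCharacter ℂ q) (a : ZMod q) : |(χ a).re| ≤ 1 :=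
  (Complex.abs_re_le_norm _).trans (χ.norm_le_one a)

/-- For `‖f‖ ≤ Λ` pointwise and `Re s > 1`: `L(f, s)` converges absolutely. [folklore] -/
private theorem lseriesSummable_of_norm_le {f : ℕ → ℂ} (hf : ∀ n, ‖f n‖ ≤ Λ n) {s : ℂ} (hs : 1 < s.re) :
    LSeriesSummable f s := by
  refine Summable.of_norm_bounded (LSeriesSummable_vonMangoldt hs).norm fun n ↦ ?_
  refine LSeries.norm_term_le s ?_
  rw [Complex.norm_real, Real.norm_of_nonneg vonMangoldt_nonneg]
  exact hf n

omit [NeZero q] in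
/-- The abscissa of absolute convergence of `L(χΛ·𝟙_{not prime}, ·)` is at most `1/2` (domination by `Λ·𝟙_{not prime}`).
[cite: Suzuki2025Chebyshev, §4.2 eq. (4.11)] -/
theorem abscissaOfAbsConv_twist_vonMangoldt_nonPrime_le (χ : DirichletCharacter ℂ q) :
    LSeries.abscissaOfAbsConv (fun n ↦ χ (n : ZMod q) * ((if n.Prime then 0 else Λ n : ℝ) : ℂ)) ≤ (1 / 2 : ℝ) := by
  refine LSeries.abscissaOfAbsConv_le_of_forall_lt_LSeriesSummable fun y hy ↦ ?_
  have h1 := HalfLinePrimeOnlyLandau.abscissaOfAbsConv_vonMangoldt_nonPrime_le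
  have h2 : LSeries.abscissaOfAbsConv (fun n ↦ ((if n.Prime then 0 else Λ n : ℝ) : ℂ)) < ((y : ℂ).re : EReal) := by
    refine lt_of_le_of_lt h1 ?_
    rw [Complex.ofReal_re, EReal.coe_lt_coe_iff]
    exact hy
  have hS := (LSeriesSummable_of_abscissaOfAbsConv_lt_re h2).norm
  refine Summable.of_norm_bounded hS fun n ↦ ?_
  refine LSeries.norm_term_le _ ?_
  rw [norm_mul]
  calc ‖χ (n : ZMod q)‖ * ‖((if n.Prime then 0 else Λ n : ℝ) : ℂ)‖
      ≤ 1 * ‖((if n.Prime then 0 else Λ n : ℝ) : ℂ)‖ := by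
        gcongr
        exact χ.norm_le_one _
    _ = _ := one_mul _

end DirichletHalfLineLandau

/-! ## Theorem 9 (first half) -/

/-- **Suzuki 2025, Theorem 9 (first half), PROVED** — discharge of the named fact `Suzuki2025Chebyshev_thm9_sign`: for a
non-principal real Dirichlet character `χ` mod `q` with `L(σ, χ) ≠ 0` for `β < σ < 1` (`1/2 ≤ β < 1`), if
`Σ_{p ≤ x} χ(p) log p · √(x/p) log(x/p) ≤ 0` for all large `x`, then `L(s, χ) ≠ 0` for `Re s > β`; in particular `β = 1/2` gives
GRH for `L(s, χ)`. Proof along §4.2: the one-signed function `G(t) = −Σ_{p ≤ e^t} χ(p)(log p/√p)(t − log p)` has Laplace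
transform `((L'/L)(½+S, χ) + L(χΛ·𝟙_{not prime}, ½+S))/S²` (`Re S > 1`), the correction being holomorphic on `Re S > 0`
((4.11)); Landau's theorem (`DirichletHalfLineLandau.lfunction_ne_zero_of_laplace_eq`).
[cite: Suzuki2025Chebyshev, §4.2 Thm 9 (first half); §2 Prop 1] -/
theorem Suzuki2025Chebyshev_thm9_sign_holds : Suzuki2025Chebyshev_thm9_sign := by
  intro q _ χ hχ hrealχ β hβ hβ1 hzfree hsign
  obtain ⟨x₀, hx₀⟩ := hsign
  -- the coefficients `d⁺ = log p · (Re χ(p))₊`, `d⁻ = log p · (−Re χ(p))₊` on the primes, both in `[0, Λ]`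
  set dp : ℕ → ℝ := fun n ↦ if n.Prime then Real.log n * max (χ (n : ZMod q)).re 0 else 0 with hdp
  set dm : ℕ → ℝ := fun n ↦ if n.Prime then Real.log n * max (-(χ (n : ZMod q)).re) 0 else 0 with hdm
  set f : ℕ → ℂ := fun n ↦ χ (n : ZMod q) * ((if n.Prime then 0 else Λ n : ℝ) : ℂ) with hf
  have hre1 : ∀ n : ℕ, |(χ (n : ZMod q)).re| ≤ 1 := fun n ↦ DirichletHalfLineLandau.abs_re_le_one χ _
  have hdp0 : ∀ n, 0 ≤ dp n := fun n ↦ by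
    simp only [hdp]
    split_ifs
    · exact mul_nonneg (Real.log_natCast_nonneg n) (le_max_right _ _)
    · exact le_rfl
  have hdm0 : ∀ n, 0 ≤ dm n := fun n ↦ by
    simp only [hdm]
    split_ifs
    · exact mul_nonneg (Real.log_natCast_nonneg n) (le_max_right _ _)
    · exact le_rfl
  have hdple : ∀ n, dp n ≤ Λ n := fun n ↦ by
    simp only [hdp]
    split_ifs with hp
    · rw [vonMangoldt_apply_prime hp]
      have h1 : max (χ (n : ZMod q)).re 0 ≤ 1 := max_le (le_trans (le_abs_self _) (hre1 n)) zero_le_one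
      have := Real.log_natCast_nonneg n
      nlinarith
    · exact vonMangoldt_nonneg
  have hdmle : ∀ n, dm n ≤ Λ n := fun n ↦ by
    simp only [hdm]
    split_ifs with hp
    · rw [vonMangoldt_apply_prime hp]
      have h1 : max (-(χ (n : ZMod q)).re) 0 ≤ 1 := max_le (le_trans (neg_le_abs _) (hre1 n)) zero_le_one
      have := Real.log_natCast_nonneg n
      nlinarith
    · exact vonMangoldt_nonneg
  -- `d⁻ − d⁺ = −Re χ(p) log p` on primes
  have hdiff : ∀ n : ℕ, dm n - dp n = -(if n.Prime then Real.log n * (χ (n : ZMod q)).re else 0) := by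
    intro n
    simp only [hdm, hdp]
    split_ifs with hp
    · have := max_zero_sub_max_neg_zero_eq_self (χ (n : ZMod q)).re
      linear_combination (-(Real.log n)) * this
    · simp
  -- `χ(n)` is real
  have hχre : ∀ n : ℕ, (((χ (n : ZMod q)).re : ℝ) : ℂ) = χ (n : ZMod q) := fun n ↦ by
    apply Complex.ext
    · simp
    · simp [hrealχ (n : ZMod q)]
  -- the one-signed function
  set G : ℝ → ℝ := fun t ↦
    (∑ n ∈ Finset.Icc 1 ⌊Real.exp t⌋₊, dm n / Real.sqrt n * (t - Real.log n))
      - ∑ n ∈ Finset.Icc 1 ⌊Real.exp t⌋₊, dp n / Real.sqrt n * (t - Real.log n) with hG_def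
  have hGm : Measurable G :=
    (DirichletHalfLineLandau.measurable_weighted hdm0).sub (DirichletHalfLineLandau.measurable_weighted hdp0)
  have hmain : ∀ s : ℂ, β < s.re → χ.LFunction s ≠ 0 := by
    refine DirichletHalfLineLandau.lfunction_ne_zero_of_laplace_eq hχ hβ hzfree hGm
      (t₀ := Real.log (max x₀ 1)) (fun t ht ↦ ?_) ?_ (c := fun _ ↦ 1)
      (P := fun s ↦ L f (1 / 2 + s))
      (by fun_prop) (fun _ _ _ ↦ one_ne_zero) ?_ (fun s hs ↦ ?_)
    · -- non-negativity beyond `log (max x₀ 1)`, from the hypothesis at `x = e^t`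
      set x : ℝ := Real.exp t with hx_def
      have hx0' : 0 < max x₀ 1 := lt_of_lt_of_le zero_lt_one (le_max_right _ _)
      have hxx : max x₀ 1 < x := by
        rw [hx_def, ← Real.exp_log hx0']
        exact Real.exp_lt_exp.2 ht
      have hx₀x : x₀ ≤ x := le_trans (le_max_left _ _) hxx.le
      have hx0 : 0 < x := Real.exp_pos _
      have hS := hx₀ x hx₀x
      rw [Finset.sum_filter] at hS
      have hkey : Real.sqrt x * G t =
          -∑ n ∈ Finset.Icc 1 ⌊x⌋₊,
            (if n.Prime then (χ (n : ZMod q)).re * Real.log n * Real.sqrt (x / n) * Real.log (x / n) else 0) := by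
        simp only [hG_def, hx_def]
        rw [← Finset.sum_sub_distrib, Finset.mul_sum, ← Finset.sum_neg_distrib]
        refine Finset.sum_congr rfl fun n hn ↦ ?_
        rw [Finset.mem_Icc] at hn
        have hn0 : (0 : ℝ) < n := by exact_mod_cast hn.1
        have hsub : dm n / Real.sqrt n * (t - Real.log n) - dp n / Real.sqrt n * (t - Real.log n) =
            (dm n - dp n) / Real.sqrt n * (t - Real.log n) := by ring
        rw [hsub, hdiff n]
        split_ifs with hp
        · rw [Real.sqrt_div (Real.exp_pos t).le, Real.log_div (Real.exp_pos t).ne' hn0.ne', Real.log_exp]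
          have hsq : Real.sqrt n ≠ 0 := Real.sqrt_ne_zero'.2 hn0
          field_simp
        · simp
      have hprod : 0 ≤ Real.sqrt x * G t := by
        rw [hkey, neg_nonneg]
        exact hS
      have hsx : 0 < Real.sqrt x := Real.sqrt_pos.2 hx0
      nlinarith
    · -- integrability of `G(t) e^{−t}`
      have h1 := (HalfLinePrimeOnlyLandau.integral_weighted_mul_cexp (d := dm) (a := -1) hdm0 hdmle
        (by norm_num)).1
      have h2 := (HalfLinePrimeOnlyLandau.integral_weighted_mul_cexp (d := dp) (a := -1) hdp0 hdple
        (by norm_num)).1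
      have h12 := h1.sub h2
      refine h12.congr_fun (fun t _ ↦ ?_) measurableSet_Ioi
      simp only [hG_def, Pi.sub_apply]
      push_cast
      ring
    · -- `P` is holomorphic on `Re S > 0`
      intro s hs'
      have hs0 : 0 < s.re := hs'
      have hmem : (1 / 2 + s) ∈ {w : ℂ | LSeries.abscissaOfAbsConv f < w.re} := by
        have h1 := DirichletHalfLineLandau.abscissaOfAbsConv_twist_vonMangoldt_nonPrime_le χ
        have h2 : ((1 / 2 : ℝ) : EReal) < (((1 / 2 + s).re : ℝ) : EReal) := by
          rw [EReal.coe_lt_coe_iff]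
          simp
          linarith
        exact lt_of_le_of_lt h1 h2
      have hL : DifferentiableAt ℂ (LSeries f) (1 / 2 + s) :=
        (LSeries_differentiableOn f).differentiableAt ((isOpen_re_gt_EReal _).mem_nhds hmem)
      exact (hL.comp s (by fun_prop)).differentiableWithinAt
    · -- the transform for `Re S > 1`
      have ha : (-s).re < -1 / 2 := by simp; linarith
      obtain ⟨hi₁, hI₁⟩ := HalfLinePrimeOnlyLandau.integral_weighted_mul_cexp (d := dm) hdm0 hdmle ha
      obtain ⟨hi₂, hI₂⟩ := HalfLinePrimeOnlyLandau.integral_weighted_mul_cexp (d := dp) hdp0 hdple ha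
      have heq : EqOn (fun t : ℝ ↦ (G t : ℂ) * cexp (-s * t))
          (fun t ↦ ((∑ n ∈ Finset.Icc 1 ⌊Real.exp t⌋₊, dm n / Real.sqrt n * (t - Real.log n) : ℝ) : ℂ) *
              cexp (-s * t)
            - ((∑ n ∈ Finset.Icc 1 ⌊Real.exp t⌋₊, dp n / Real.sqrt n * (t - Real.log n) : ℝ) : ℂ) *
              cexp (-s * t)) (Ioi 0) := by
        intro t _
        simp only [hG_def]
        push_cast
        ring
      rw [setIntegral_congr_fun measurableSet_Ioi heq, integral_sub hi₁ hi₂, hI₁, hI₂,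
        show (1 / 2 : ℂ) - -s = 1 / 2 + s by ring]
      have hw : 1 < (1 / 2 + s : ℂ).re := by simp; linarith
      -- summability of the four series at `w = 1/2 + s`
      have hSm : LSeriesSummable (fun n ↦ (dm n : ℂ)) (1 / 2 + s) :=
        DirichletHalfLineLandau.lseriesSummable_of_norm_le (fun n ↦ by
          rw [Complex.norm_real, Real.norm_of_nonneg (hdm0 n)]; exact hdmle n) hw
      have hSp : LSeriesSummable (fun n ↦ (dp n : ℂ)) (1 / 2 + s) :=
        DirichletHalfLineLandau.lseriesSummable_of_norm_le (fun n ↦ by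
          rw [Complex.norm_real, Real.norm_of_nonneg (hdp0 n)]; exact hdple n) hw
      have hSf : LSeriesSummable f (1 / 2 + s) :=
        DirichletHalfLineLandau.lseriesSummable_of_norm_le (fun n ↦ by
          simp only [hf]
          rw [norm_mul]
          have h0 : 0 ≤ (if n.Prime then 0 else Λ n : ℝ) := by split_ifs <;> simp [vonMangoldt_nonneg]
          have hle : (if n.Prime then 0 else Λ n : ℝ) ≤ Λ n := by split_ifs <;> simp [vonMangoldt_nonneg]
          rw [Complex.norm_real, Real.norm_of_nonneg h0]
          calc ‖χ (n : ZMod q)‖ * (if n.Prime then 0 else Λ n : ℝ) ≤ 1 * (if n.Prime then 0 else Λ n : ℝ) := by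
                gcongr; exact χ.norm_le_one _
            _ ≤ Λ n := by rw [one_mul]; exact hle) hw
      have hSχ : LSeriesSummable (↗χ * ↗Λ) (1 / 2 + s) :=
        DirichletCharacter.LSeriesSummable_twist_vonMangoldt χ hw
      -- `L(d⁻) − L(d⁺) = −(L(χΛ) − L(χΛ·𝟙_{not prime}))`
      have hA : L (fun n ↦ (dm n : ℂ)) (1 / 2 + s) - L (fun n ↦ (dp n : ℂ)) (1 / 2 + s) =
          -(L (↗χ * ↗Λ) (1 / 2 + s) - L f (1 / 2 + s)) := by
        rw [← LSeries_sub hSm hSp, ← LSeries_sub hSχ hSf, ← LSeries_neg]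
        congr 1
        funext n
        simp only [Pi.sub_apply, Pi.neg_apply, Pi.mul_apply, hf]
        have h := hdiff n
        have h' : ((dm n : ℝ) : ℂ) - ((dp n : ℝ) : ℂ) = (((dm n - dp n : ℝ)) : ℂ) := by push_cast; ring
        rw [h', h]
        split_ifs with hp
        · rw [vonMangoldt_apply_prime hp]
          conv_rhs => rw [← hχre n]
          push_cast
          ring
        · push_cast
          ring
      -- `L(χΛ, w) = −(L'/L)(w, χ)`
      have hB : L (↗χ * ↗Λ) (1 / 2 + s) = -logDeriv χ.LFunction (1 / 2 + s) := by
        rw [DirichletCharacter.LSeries_twist_vonMangoldt_eq χ hw, logDeriv_apply,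
          DirichletCharacter.LFunction_eq_LSeries χ hw, DirichletCharacter.deriv_LFunction_eq_deriv_LSeries χ hw,
          neg_div]
      have hs0 : s ≠ 0 := fun h ↦ by rw [h, zero_re] at hs; linarith
      rw [← mul_sub, hA, hB]
      field_simp
      ring
  exact ⟨hmain, fun hβeq ↦ DirichletHalfLineLandau.riemannHypothesis_of_forall_ne_zero hχ
    (fun s hs ↦ hmain s (by rw [hβeq]; exact hs))⟩

/-! ## Theorem 8 (first half) -/

/-- `Λ(n) Re χ(n) = (χ(n)Λ(n) + χ̄(n)Λ(n))/2` in `ℂ` (`χ̄ = χ⁻¹` pointwise). [folklore] -/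
private theorem vonMangoldt_mul_re_eq {q : ℕ} (χ : DirichletCharacter ℂ q) (n : ℕ) :
    ((Λ n * (χ (n : ZMod q)).re : ℝ) : ℂ) =
      (χ (n : ZMod q) * (Λ n : ℂ) + χ⁻¹ (n : ZMod q) * (Λ n : ℂ)) / 2 := by
  rw [← MulChar.star_apply', Complex.star_def, ← add_mul]
  push_cast
  rw [Complex.re_eq_add_conj]
  ring

/-- **Suzuki 2025, Theorem 8 (first half), PROVED** — discharge of the named fact `Suzuki2025Chebyshev_thm8_sign`: for a
non-principal Dirichlet character `χ` mod `q` with `L(σ, χ) ≠ 0` for `β < σ < 1` (`1/2 ≤ β < 1`), if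
`Σ_{n ≤ x} Λ(n) Re χ(n)/√n · log(x/n)` keeps a constant sign for all large `x`, then `L(s, χ) ≠ 0` for `Re s > β`; in particular
`β = 1/2` gives GRH for `L(s, χ)`. Proof along §4.1: with `Z₀(s) = L(s, χ)L(s, χ̄)` (entire, `χ̄ = χ⁻¹ ≠ χ₀`; no real zeros in
`(β, 1)` by the hypothesis and the reflection `L(σ, χ̄) = conj L(σ, χ)`), the one-signed function
`G(t) = ± Σ_{n ≤ e^t} Λ(n) Re χ(n)/√n (t − log n)` has Laplace transform `∓(1/2)(Z₀'/Z₀)(½+S)/S²` (`Re S > 1`;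
`Σ Λ(n) Re χ(n) n^{-w} = −½[(L'/L)(w, χ) + (L'/L)(w, χ̄)]`, Mathlib's `LSeries_twist_vonMangoldt_eq`); Landau's theorem
(`DirichletHalfLineLandau.entire_ne_zero_of_laplace_eq`) gives `Z₀ ≠ 0`, hence `L(·, χ) ≠ 0`, on `Re s > β`.
[cite: Suzuki2025Chebyshev, §4.1 Thm 8 (first half); §2 Prop 1] -/
theorem Suzuki2025Chebyshev_thm8_sign_holds : Suzuki2025Chebyshev_thm8_sign := by
  intro q _ χ hχ β hβ hβ1 hzfree hsign
  obtain ⟨x₀, hx₀2, hx₀⟩ := hsign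
  have hχ' : χ⁻¹ ≠ 1 := inv_ne_one.mpr hχ
  -- the sign `η = ±1` making `η · Σ_{n ≤ x} Λ(n) Re χ(n)/√n log(x/n) ≥ 0` for `x ≥ x₀`
  obtain ⟨η, hη, hGpos⟩ : ∃ η : ℝ, (η = 1 ∨ η = -1) ∧ ∀ x : ℝ, x₀ ≤ x →
      0 ≤ η * ∑ n ∈ Finset.Icc 1 ⌊x⌋₊, Λ n * (χ (n : ZMod q)).re / Real.sqrt n * Real.log (x / n) := by
    rcases hx₀ with h | h
    · exact ⟨1, Or.inl rfl, fun x hx ↦ by rw [one_mul]; exact h x hx⟩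
    · exact ⟨-1, Or.inr rfl, fun x hx ↦ by rw [neg_one_mul, neg_nonneg]; exact h x hx⟩
  have hη0 : η ≠ 0 := by rcases hη with rfl | rfl <;> norm_num
  -- the coefficients `d⁺ = Λ · (Re χ)₊`, `d⁻ = Λ · (−Re χ)₊`, both in `[0, Λ]`, `d⁺ − d⁻ = Λ Re χ`
  set dp : ℕ → ℝ := fun n ↦ Λ n * max (χ (n : ZMod q)).re 0 with hdp
  set dm : ℕ → ℝ := fun n ↦ Λ n * max (-(χ (n : ZMod q)).re) 0 with hdm
  set g : ℕ → ℂ := fun n ↦ ((Λ n * (χ (n : ZMod q)).re : ℝ) : ℂ) with hg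
  have hre1 : ∀ n : ℕ, |(χ (n : ZMod q)).re| ≤ 1 := fun n ↦ DirichletHalfLineLandau.abs_re_le_one χ _
  have hdp0 : ∀ n, 0 ≤ dp n := fun n ↦ mul_nonneg vonMangoldt_nonneg (le_max_right _ _)
  have hdm0 : ∀ n, 0 ≤ dm n := fun n ↦ mul_nonneg vonMangoldt_nonneg (le_max_right _ _)
  have hdple : ∀ n, dp n ≤ Λ n := fun n ↦ by
    have h1 : max (χ (n : ZMod q)).re 0 ≤ 1 := max_le (le_trans (le_abs_self _) (hre1 n)) zero_le_one
    exact mul_le_of_le_one_right vonMangoldt_nonneg h1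
  have hdmle : ∀ n, dm n ≤ Λ n := fun n ↦ by
    have h1 : max (-(χ (n : ZMod q)).re) 0 ≤ 1 := max_le (le_trans (neg_le_abs _) (hre1 n)) zero_le_one
    exact mul_le_of_le_one_right vonMangoldt_nonneg h1
  have hdiff : ∀ n : ℕ, dp n - dm n = Λ n * (χ (n : ZMod q)).re := by
    intro n
    simp only [hdp, hdm]
    have := max_zero_sub_max_neg_zero_eq_self (χ (n : ZMod q)).re
    linear_combination (Λ n) * this
  -- `Z₀ = L(·, χ) L(·, χ̄)`: entire, zero-free on `Re s ≥ 1` and at real `β < σ < 1`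
  set Z₀ : ℂ → ℂ := fun s ↦ χ.LFunction s * χ⁻¹.LFunction s with hZ₀_def
  have hdχ := DirichletCharacter.differentiable_LFunction hχ
  have hdχ' := DirichletCharacter.differentiable_LFunction hχ'
  have hZ₀d : Differentiable ℂ Z₀ := hdχ.mul hdχ'
  have hZ₀right : ∀ s : ℂ, 1 ≤ s.re → Z₀ s ≠ 0 := fun s hs ↦
    mul_ne_zero (DirichletCharacter.LFunction_ne_zero_of_one_le_re χ (Or.inl hχ) hs)
      (DirichletCharacter.LFunction_ne_zero_of_one_le_re χ⁻¹ (Or.inl hχ') hs)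
  have hZ₀real : ∀ σ : ℝ, β < σ → σ < 1 → Z₀ σ ≠ 0 := by
    intro σ h1 h2
    have hL := hzfree σ h1 h2
    refine mul_ne_zero hL ?_
    rw [← DirichletZFR.conj_LFunction_conj χ hχ (σ : ℂ), Complex.conj_ofReal]
    exact (map_ne_zero (starRingEnd ℂ)).2 hL
  -- the one-signed function
  set G : ℝ → ℝ := fun t ↦ η *
    ((∑ n ∈ Finset.Icc 1 ⌊Real.exp t⌋₊, dp n / Real.sqrt n * (t - Real.log n))
      - ∑ n ∈ Finset.Icc 1 ⌊Real.exp t⌋₊, dm n / Real.sqrt n * (t - Real.log n)) with hG_def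
  have hGm : Measurable G :=
    ((DirichletHalfLineLandau.measurable_weighted hdp0).sub
      (DirichletHalfLineLandau.measurable_weighted hdm0)).const_mul η
  have hx₀0 : 0 < x₀ := by linarith
  have hZ : ∀ s : ℂ, β < s.re → Z₀ s ≠ 0 := by
    refine DirichletHalfLineLandau.entire_ne_zero_of_laplace_eq hZ₀d hZ₀right hβ hZ₀real hGm
      (t₀ := Real.log x₀) (fun t ht ↦ ?_) ?_ (c := fun _ ↦ -((η : ℂ) / 2)) (P := fun _ ↦ 0)
      (by fun_prop) (fun _ _ _ ↦ ?_) (by fun_prop) (fun s hs ↦ ?_)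
    · -- non-negativity beyond `log x₀`, from the hypothesis at `x = e^t`
      set x : ℝ := Real.exp t with hx_def
      have hxx : x₀ < x := by
        rw [hx_def, ← Real.exp_log hx₀0]
        exact Real.exp_lt_exp.2 ht
      have hS := hGpos x hxx.le
      have hkey : G t = η * ∑ n ∈ Finset.Icc 1 ⌊x⌋₊,
          Λ n * (χ (n : ZMod q)).re / Real.sqrt n * Real.log (x / n) := by
        simp only [hG_def, hx_def]
        congr 1
        rw [← Finset.sum_sub_distrib]
        refine Finset.sum_congr rfl fun n hn ↦ ?_
        rw [Finset.mem_Icc] at hn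
        have hn0 : (0 : ℝ) < n := by exact_mod_cast hn.1
        rw [Real.log_div (Real.exp_pos t).ne' hn0.ne', Real.log_exp, ← sub_mul, ← sub_div, hdiff n]
      rw [hkey]
      exact hS
    · -- integrability of `G(t) e^{−t}`
      have h1 := (HalfLinePrimeOnlyLandau.integral_weighted_mul_cexp (d := dp) (a := -1) hdp0 hdple
        (by norm_num)).1
      have h2 := (HalfLinePrimeOnlyLandau.integral_weighted_mul_cexp (d := dm) (a := -1) hdm0 hdmle
        (by norm_num)).1
      have h12 : IntegrableOn (fun t : ℝ ↦ (η : ℂ) *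
          ((fun t : ℝ ↦ ((∑ n ∈ Finset.Icc 1 ⌊Real.exp t⌋₊, dp n / Real.sqrt n * (t - Real.log n) : ℝ) : ℂ) *
              cexp (-1 * (t : ℂ)))
            - (fun t : ℝ ↦ ((∑ n ∈ Finset.Icc 1 ⌊Real.exp t⌋₊, dm n / Real.sqrt n * (t - Real.log n) : ℝ) : ℂ) *
              cexp (-1 * (t : ℂ)))) t) (Ioi 0) := (h1.sub h2).const_mul (η : ℂ)
      refine h12.congr_fun (fun t _ ↦ ?_) measurableSet_Ioi
      simp only [hG_def, Pi.sub_apply]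
      push_cast
      ring
    · -- `c = −η/2 ≠ 0`
      exact neg_ne_zero.2 (div_ne_zero (Complex.ofReal_ne_zero.2 hη0) two_ne_zero)
    · -- the transform for `Re S > 1`
      have ha : (-s).re < -1 / 2 := by simp; linarith
      obtain ⟨hi₁, hI₁⟩ := HalfLinePrimeOnlyLandau.integral_weighted_mul_cexp (d := dp) hdp0 hdple ha
      obtain ⟨hi₂, hI₂⟩ := HalfLinePrimeOnlyLandau.integral_weighted_mul_cexp (d := dm) hdm0 hdmle ha
      have heq : EqOn (fun t : ℝ ↦ (G t : ℂ) * cexp (-s * t))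
          (fun t ↦ (η : ℂ) *
            (((∑ n ∈ Finset.Icc 1 ⌊Real.exp t⌋₊, dp n / Real.sqrt n * (t - Real.log n) : ℝ) : ℂ) *
                cexp (-s * t)
              - ((∑ n ∈ Finset.Icc 1 ⌊Real.exp t⌋₊, dm n / Real.sqrt n * (t - Real.log n) : ℝ) : ℂ) *
                cexp (-s * t))) (Ioi 0) := by
        intro t _
        simp only [hG_def]
        push_cast
        ring
      rw [setIntegral_congr_fun measurableSet_Ioi heq, integral_const_mul, integral_sub hi₁ hi₂, hI₁, hI₂,
        show (1 / 2 : ℂ) - -s = 1 / 2 + s by ring]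
      set w : ℂ := 1 / 2 + s with hw_def
      have hw : 1 < w.re := by simp [hw_def]; linarith
      -- summability of the series at `w`
      have hSp : LSeriesSummable (fun n ↦ (dp n : ℂ)) w :=
        DirichletHalfLineLandau.lseriesSummable_of_norm_le (fun n ↦ by
          rw [Complex.norm_real, Real.norm_of_nonneg (hdp0 n)]; exact hdple n) hw
      have hSm : LSeriesSummable (fun n ↦ (dm n : ℂ)) w :=
        DirichletHalfLineLandau.lseriesSummable_of_norm_le (fun n ↦ by
          rw [Complex.norm_real, Real.norm_of_nonneg (hdm0 n)]; exact hdmle n) hw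
      have hSg : LSeriesSummable g w :=
        DirichletHalfLineLandau.lseriesSummable_of_norm_le (fun n ↦ by
          simp only [hg]
          rw [Complex.norm_real, Real.norm_eq_abs, abs_mul, abs_of_nonneg vonMangoldt_nonneg]
          exact mul_le_of_le_one_right vonMangoldt_nonneg (hre1 n)) hw
      have hSχ : LSeriesSummable (↗χ * ↗Λ) w := DirichletCharacter.LSeriesSummable_twist_vonMangoldt χ hw
      have hSχ' : LSeriesSummable (↗χ⁻¹ * ↗Λ) w := DirichletCharacter.LSeriesSummable_twist_vonMangoldt χ⁻¹ hw
      -- `L(d⁺) − L(d⁻) = L(Λ Re χ)` and `L(χΛ) + L(χ̄Λ) = 2 L(Λ Re χ)`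
      have hA : L (fun n ↦ (dp n : ℂ)) w - L (fun n ↦ (dm n : ℂ)) w = L g w := by
        rw [← LSeries_sub hSp hSm]
        congr 1
        funext n
        simp only [Pi.sub_apply, hg]
        rw [← hdiff n]
        push_cast
        ring
      have hsum : L (↗χ * ↗Λ) w + L (↗χ⁻¹ * ↗Λ) w = 2 * L g w := by
        rw [← LSeries_add hSχ hSχ', two_mul, ← LSeries_add hSg hSg]
        congr 1
        funext n
        simp only [Pi.add_apply, Pi.mul_apply, hg]
        rw [vonMangoldt_mul_re_eq χ n]
        ring
      -- `L(χΛ, w) = −(L'/L)(w, χ)`, the same for `χ̄`, and `(Z₀'/Z₀) = (L'/L)(·, χ) + (L'/L)(·, χ̄)`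
      have hB : L (↗χ * ↗Λ) w = -logDeriv χ.LFunction w := by
        rw [DirichletCharacter.LSeries_twist_vonMangoldt_eq χ hw, logDeriv_apply,
          DirichletCharacter.LFunction_eq_LSeries χ hw, DirichletCharacter.deriv_LFunction_eq_deriv_LSeries χ hw,
          neg_div]
      have hB' : L (↗χ⁻¹ * ↗Λ) w = -logDeriv χ⁻¹.LFunction w := by
        rw [DirichletCharacter.LSeries_twist_vonMangoldt_eq χ⁻¹ hw, logDeriv_apply,
          DirichletCharacter.LFunction_eq_LSeries χ⁻¹ hw,
          DirichletCharacter.deriv_LFunction_eq_deriv_LSeries χ⁻¹ hw, neg_div]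
      have hZlog : logDeriv Z₀ w = logDeriv χ.LFunction w + logDeriv χ⁻¹.LFunction w :=
        logDeriv_mul (f := χ.LFunction) (g := χ⁻¹.LFunction) w
          (DirichletCharacter.LFunction_ne_zero_of_one_le_re χ (Or.inl hχ) hw.le)
          (DirichletCharacter.LFunction_ne_zero_of_one_le_re χ⁻¹ (Or.inl hχ') hw.le) (hdχ w) (hdχ' w)
      have hlogg : logDeriv Z₀ w = -(2 * L g w) := by
        rw [hZlog, ← hsum, hB, hB']
        ring
      have hs0 : s ≠ 0 := fun h ↦ by rw [h, zero_re] at hs; linarith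
      rw [← mul_sub, hA, hlogg]
      field_simp
      ring
  have hmain : ∀ s : ℂ, β < s.re → χ.LFunction s ≠ 0 := fun s hs h0 ↦
    hZ s hs (by simp only [hZ₀_def]; rw [h0, zero_mul])
  exact ⟨hmain, fun hβeq ↦ DirichletHalfLineLandau.riemannHypothesis_of_forall_ne_zero hχ
    (fun s hs ↦ hmain s (by rw [hβeq]; exact hs))⟩

end Literature.NumberTheory.LFunctions

end
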